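import Literature.NumberTheory.DiophantineGeometry.ComplexEllipticCurveFundamentalDomain
import HarnessLib

/-!
# Löbrich's explicit comparison `h_F(E) + ½ log π > h(j_E)/12 − ½ log(1 + h(j_E)) − 2.071`

Topic `NumberTheory/DiophantineGeometry`. S. Löbrich, *A gap in the spectrum of the Faltings
height*, J. Théor. Nombres Bordeaux **29** (2017) 289–305 [Lobrich2017; held:
`paper:arxiv-1505.00602`], §3 Prop. 3.2: "Let `E/K` be an elliptic curve over a number field `K`
with `j`-invariant `j_E`. Then
`h(E/K) > (1/12) h(j_E) − ½ log(1 + h(j_E)) + (1/(12[K:ℚ])) log|N_{K/ℚ}(γ_{E/K})| − 2.071`",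
where `h(E/K)` is Deligne's normalisation of the Faltings height (`= h_F + ½ log π`, loc. cit.
Remark 2.1) and `γ_{E/K}` the unstable discriminant (`= 𝓞_K` iff `E/K` is semistable). Over a
finite extension where `E` is semistable the left side is the STABLE height and the `γ`-term
vanishes, so the stable form is
`h_F^{st}(E) + ½ log π > h(j_E)/12 − ½ log(1 + h(j_E)) − 2.071`; together with the lower
inequality of Silverman's Prop. 2.1 (Löbrich Prop. 3.1, "Gaudron and Rémond showed that one can
choose `C₁ = 0.72`") this is [ExpEst] (Mochizuki–Fesenko–Hoshi–Minamide–Porowski 2022) Prop. 1.10,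
the tree's named fact `Literature.IUT.LogVolume.ExpEst.Prop110`, discharged in the companion
`Literature/IUT/LogVolume/ExplicitEstimatesProp110Proof.lean`.

## The proof, and where it deviates from print

Löbrich (§3, Lemmas 3.1–3.3 and pp. 296–297): with `τ_σ` in the closed fundamental domain `F̄`,
`log max{1, |j(τ)|} ≤ 2π Im τ + 7.09` (Faisant–Philibert), `log|Δ̃(τ)| < −2π Im τ + 22.16`,
`Im τ ≤ (3/2) log max{e, |j(τ)|}`, then `12 d h(E/K) ≥ Σ_𝔭 … − Σ_σ log(|Δ̃(τ_σ)| (Im τ_σ)⁶) + 6d log π`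
and the AM–GM inequality. We follow the SAME architecture through the tree's closed formula
`12 [K:ℚ] h_F^{st} = log N(𝔇_j) − Σ_σ archTerm_σ` (`WeierstrassCurve.stableFaltingsHeight`) and the
per-embedding identity of `FaltingsHeightJInvariantExplicit`
(`log max(|j|,1) + archTerm = log(4096 π¹²) + log max(|Δ(τ)|, |E₄(τ)|³) + 6 log Im τ`), with two
shorter roads that Mathlib provides: (1) the period lattice is reduced into the fundamental domain
`𝒟` by Mathlib's `ModularGroup.exists_smul_mem_fd` (the tree's normal form only has `Im τ ≥ 1/2`),
so `Im τ ≥ 0.86`, `|q| ≤ e^{−5.4} ≤ 1/200`; (2) instead of the Faisant–Philibert bounds for `j` we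
bound `|E₄(τ)| ≤ 5/2` on `𝒟` from the `q`-expansion (`E₄ = 1 + 240 Σ σ₃(n) qⁿ`, first term peeled
off as in the tree's `norm_E₄_sub_one_le`) and keep the tree's `Im τ ≤ 1 + log max(|j|, 1)`; this
gives the per-embedding constant `log(65536 π¹²) ≈ 24.83` where Löbrich's roundings give
`12·2.071 + 6 log π ≈ 31.72` — i.e. a slightly STRONGER inequality than Prop. 3.2 (stable form),
from which the printed constant `2.071` follows. Everything here is proved; no definitions, no
named facts. The normal form `τ ∈ 𝒟` of a complex elliptic curve is the companion
`ComplexEllipticCurveFundamentalDomain` (`FaltingsHeightFd.exists_fd_tau`).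

## Main statements

* `norm_E₄_le_of_three_le` : `3 ≤ 4 (Im τ)² → ‖E₄ τ‖ ≤ 5/2`.
* `log_max_j_add_faltingsArchTerm_le_fd` : per embedding,
  `log max(|j|,1) + archTerm ≤ 6 log(1 + log max(|j|,1)) + log(65536 π¹²)`.
* `jHeight_le_stableFaltingsHeight_fd` : `h(j_E) ≤ 12 h_F^{st}(E) + 6 log(1 + h(j_E)) + log(65536 π¹²)`
  (and `… + 25`).
* `lobrich2017_prop32_stable` : `0 ≤ h(j_E)/12 − (h_F^{st}(E) + ½ log π) ≤ ½ log(1 + h(j_E)) + 2.071`.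

## References

* S. Löbrich, *A gap in the spectrum of the Faltings height*, JTNB 29 (2017), §3. [Lobrich2017]
* J. H. Silverman, *Heights and elliptic curves*, in Arithmetic Geometry (1986), Prop. 2.1. [Silverman1986]
* S. Mochizuki, I. Fesenko, Y. Hoshi, A. Minamide, W. Porowski, *Explicit estimates in
  inter-universal Teichmüller theory*, Kodai Math. J. 45 (2022), Prop. 1.10. [MochizukiEtAl2022]
-/

noncomputable section

namespace Literature.NumberTheory.DiophantineGeometry

namespace FaltingsHeightLobrich

open _root_.NumberField _root_.WeierstrassCurve _root_.Height
open _root_.Complex _root_.UpperHalfPlane _root_.EisensteinSeries _root_.ModularForm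
open scoped MatrixGroups Real Modular
open Literature.NumberTheory.EllipticCurves FaltingsHeightExplicit FaltingsHeightFd

/-! ### Numerical constants -/

/-- `e^{−27/5} ≤ 1/200` (`e⁵ ≥ 148`, `e^{2/5} ≥ 7/5`). [folklore] -/
private theorem exp_neg_le_inv_two_hundred : Real.exp (-(27 / 5 : ℝ)) ≤ 1 / 200 := by
  have h1 : (2.7182818283 : ℝ) < Real.exp 1 := Real.exp_one_gt_d9
  have h5 : (148 : ℝ) ≤ Real.exp 5 := by
    have : Real.exp 5 = Real.exp 1 ^ 5 := by rw [← Real.exp_nat_mul]; norm_num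
    rw [this]
    exact le_trans (by norm_num) (pow_le_pow_left₀ (by norm_num) h1.le 5)
  have h04 : (2 / 5 : ℝ) + 1 ≤ Real.exp (2 / 5) := Real.add_one_le_exp _
  have h54 : (200 : ℝ) ≤ Real.exp (27 / 5) := by
    rw [show (27 / 5 : ℝ) = 5 + 2 / 5 by norm_num, Real.exp_add]
    nlinarith [Real.exp_pos (2 / 5 : ℝ), Real.exp_pos (5 : ℝ)]
  rw [Real.exp_neg, one_div, inv_le_inv₀ (Real.exp_pos _) (by norm_num)]
  exact h54

/-- `3 ≤ 4 (Im τ)²` (i.e. `Im τ ≥ √3/2`, as for `τ ∈ 𝒟`) gives `Im τ ≥ 43/50`. [folklore] -/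
private theorem im_ge_of_three_le {τ : ℍ} (h : 3 ≤ 4 * τ.im ^ 2) : (43 / 50 : ℝ) ≤ τ.im := by
  have h0 : 0 < τ.im := τ.im_pos
  rcases le_or_gt (43 / 50 : ℝ) τ.im with hge | hlt
  · exact hge
  · have : τ.im ^ 2 < (43 / 50 : ℝ) ^ 2 := by
      have := mul_lt_mul'' hlt hlt h0.le h0.le
      nlinarith
    norm_num at this
    linarith

/-- `|q| = e^{−2π Im τ} ≤ 1/200` when `3 ≤ 4 (Im τ)²` (`2π · 0.86 ≥ 5.4`). [folklore] -/
private theorem exp_neg_two_pi_mul_im_le {τ : ℍ} (h : 3 ≤ 4 * τ.im ^ 2) :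
    Real.exp (-(2 * π * τ.im)) ≤ 1 / 200 := by
  have hy := im_ge_of_three_le h
  have hπ : (3.14 : ℝ) < π := Real.pi_gt_d2
  refine le_trans (Real.exp_le_exp.mpr ?_) exp_neg_le_inv_two_hundred
  nlinarith

/-! ### `|E₄(τ)| ≤ 5/2` on the fundamental domain -/

open scoped ArithmeticFunction.sigma in
/-- **`|E₄(τ) − 1| ≤ 7/5` when `3 ≤ 4 (Im τ)²`** (in particular on `𝒟`): `E₄ = 1 + 240 Σ_{n≥1} σ₃(n) qⁿ`,
`|q| = r ≤ 1/200`, `|Σ| ≤ r + Σ_{n≥2} 2(4r)ⁿ = r + 32r²/(1 − 4r) ≤ 7/1200` (the argument of the tree's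
`FaltingsHeightExplicit.norm_E₄_sub_one_le`, which is the case `Im τ ≥ 1`; Silverman's §2 eq. (5),
the `q`-expansion `E₄ = 1 + 240 Σ σ₃(n)qⁿ`, made quantitative on `𝒟`). [cite: Silverman1986, §2 eq. (5)] -/
theorem norm_E₄_sub_one_le_of_three_le (τ : ℍ) (hτ : 3 ≤ 4 * τ.im ^ 2) :
    ‖(E₄ τ : ℂ) - 1‖ ≤ 7 / 5 := by
  have h := EisensteinSeries.q_expansion_bernoulli (by norm_num : 3 ≤ 4) (by decide) τ
  have hb : bernoulli 4 = -1 / 30 := by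
    rw [bernoulli_eq_bernoulli'_of_ne_one (by norm_num), bernoulli'_four]
  simp_rw [zpow_natCast] at h
  rw [hb] at h
  set q : ℂ := cexp (2 * π * Complex.I * τ) with hqdef
  set r : ℝ := ‖q‖ with hrdef
  have hr : r = Real.exp (-(2 * π * τ.im)) := by
    rw [hrdef, hqdef, Complex.norm_exp]
    congr 1
    simp [Complex.mul_re, UpperHalfPlane.coe_im, UpperHalfPlane.coe_re]
  have h' : (E₄ τ : ℂ) = 1 + 240 * ∑' n : ℕ+, (σ 3 n : ℂ) * q ^ (n : ℕ) := by
    rw [show (E₄ τ : ℂ) = E (by norm_num : 3 ≤ 4) τ from rfl, h]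
    simp only [show (4 - 1 : ℕ) = 3 from rfl]
    push_cast
    ring
  have hr0 : 0 ≤ r := norm_nonneg _
  have hr200 : r ≤ 1 / 200 := by rw [hr]; exact exp_neg_two_pi_mul_im_le hτ
  have h4r : 4 * r < 1 := by linarith
  have h4r0 : 0 ≤ 4 * r := by linarith
  -- the series over `ℕ`
  set g : ℕ → ℂ := fun m ↦ (σ 3 (m + 1) : ℂ) * q ^ (m + 1) with hgdef
  have hS : ∑' n : ℕ+, (σ 3 n : ℂ) * q ^ (n : ℕ) = ∑' m : ℕ, g m :=
    tsum_pnat_eq_tsum_succ (f := fun n : ℕ ↦ (σ 3 n : ℂ) * q ^ n)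
  have hbound : ∀ m, ‖g m‖ ≤ 2 * (4 * r) ^ (m + 1) := fun m ↦ by
    rw [hgdef]
    simp only [norm_mul, norm_pow, Complex.norm_natCast, ← hrdef]
    calc (σ 3 (m + 1) : ℝ) * r ^ (m + 1) ≤ 2 * 4 ^ (m + 1) * r ^ (m + 1) := by
          gcongr; exact sigma_three_le _
      _ = 2 * (4 * r) ^ (m + 1) := by rw [mul_pow]; ring
  have hgeom : Summable (fun m : ℕ ↦ 2 * (4 * r) ^ (m + 1)) := by
    have := (summable_geometric_of_lt_one h4r0 h4r).mul_left (2 * (4 * r))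
    refine this.congr (fun m ↦ ?_); ring
  have hsum : Summable g := Summable.of_norm_bounded hgeom hbound
  have hsplit := hsum.tsum_eq_zero_add
  have hg0 : g 0 = q := by
    simp [hgdef, ArithmeticFunction.sigma_apply, Nat.divisors_one]
  have hgeom2 : Summable (fun m : ℕ ↦ 2 * (4 * r) ^ (m + 2)) := by
    have := (summable_geometric_of_lt_one h4r0 h4r).mul_left (2 * (4 * r) ^ 2)
    refine this.congr (fun m ↦ ?_); ring
  have htail_le : ‖∑' m, g (m + 1)‖ ≤ 2 * (4 * r) ^ 2 / (1 - 4 * r) := by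
    have h1 : ‖∑' m, g (m + 1)‖ ≤ ∑' m : ℕ, 2 * (4 * r) ^ (m + 2) :=
      tsum_of_norm_bounded hgeom2.hasSum fun m ↦ by
        have := hbound (m + 1); rwa [show m + 1 + 1 = m + 2 by ring] at this
    have hval : ∑' m : ℕ, 2 * (4 * r) ^ (m + 2) = 2 * (4 * r) ^ 2 / (1 - 4 * r) := by
      rw [show (fun m : ℕ ↦ 2 * (4 * r) ^ (m + 2)) = fun m ↦ (2 * (4 * r) ^ 2) * (4 * r) ^ m by
        funext m; ring]
      rw [tsum_mul_left, tsum_geometric_of_lt_one h4r0 h4r]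
      field_simp
    rw [hval] at h1; exact h1
  -- `E₄ τ - 1 = 240 * (q + tail)`
  have hE : (E₄ τ : ℂ) - 1 = 240 * (q + ∑' m, g (m + 1)) := by
    rw [h', hS, hsplit, hg0]
    ring
  rw [hE, norm_mul, Complex.norm_ofNat]
  have hq : ‖q + ∑' m, g (m + 1)‖ ≤ r + 2 * (4 * r) ^ 2 / (1 - 4 * r) :=
    (norm_add_le _ _).trans (add_le_add le_rfl htail_le)
  have hnum : r + 2 * (4 * r) ^ 2 / (1 - 4 * r) ≤ 7 / 1200 := by
    have h49 : (49 / 50 : ℝ) ≤ 1 - 4 * r := by linarith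
    have hsq : 2 * (4 * r) ^ 2 / (1 - 4 * r) ≤ 2 * (4 * r) ^ 2 / (49 / 50) :=
      div_le_div_of_nonneg_left (by positivity) (by norm_num) h49
    have hr2 : (4 * r) ^ 2 ≤ (1 / 50) ^ 2 := pow_le_pow_left₀ h4r0 (by linarith) 2
    have hsq' : 2 * (4 * r) ^ 2 / (49 / 50) ≤ 2 * (1 / 50) ^ 2 / (49 / 50) := by
      gcongr
    have : (2 * (1 / 50) ^ 2 / (49 / 50) : ℝ) ≤ 1 / 1200 := by norm_num
    linarith
  nlinarith [norm_nonneg (q + ∑' m, g (m + 1))]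

/-- **`|E₄(τ)| ≤ 5/2` when `3 ≤ 4 (Im τ)²`**, in particular for `τ` in the fundamental domain `𝒟`
(quantitative form of Silverman's §2 eq. (5) "`E₄ = 1 + 240 Σ σ₃(n) qⁿ`" on `𝒟`).
[cite: Silverman1986, §2 eq. (5)] -/
theorem norm_E₄_le_of_three_le (τ : ℍ) (hτ : 3 ≤ 4 * τ.im ^ 2) : ‖(E₄ τ : ℂ)‖ ≤ 5 / 2 := by
  have h := norm_E₄_sub_one_le_of_three_le τ hτ
  have h1 : ‖(E₄ τ : ℂ)‖ ≤ ‖(E₄ τ : ℂ) - 1‖ + ‖(1 : ℂ)‖ := by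
    have := norm_add_le ((E₄ τ : ℂ) - 1) (1 : ℂ)
    rwa [sub_add_cancel] at this
  rw [norm_one] at h1
  linarith

/-! ### The per-embedding upper bound with Löbrich-type constant -/

/-- **`log max(|j(V)|, 1) + (log|Δ_V| + 6 log((i/2)∫ω∧ω̄)) ≤ 6 log(1 + log max(|j(V)|, 1)) + log(65536 π¹²)`
for every elliptic curve `V/ℂ`** — the archimedean estimate of Löbrich's proof of Prop. 3.2 at one
place ("`−log|Δ(τ)| > log max{1, |j(τ)|} − 29.25`", "`log Im τ < log log max{e, |j(τ)|} + 0.41`"),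
here with `τ ∈ 𝒟`: `max(|j|,1)·|Δ(τ)| = max(|Δ(τ)|, |E₄(τ)|³) ≤ max(4e^{−2π Im τ}, (5/2)³) ≤ 16` and
`Im τ ≤ 1 + log max(|j|, 1)` (for `Im τ ≥ 1`, `|j| = |E₄|³/|Δ| ≥ e^{2π Im τ}/256`).
[cite: Lobrich2017, §3 proof of Prop. 3.2 (Lemmas 3.2, 3.3)] -/
theorem log_max_j_add_faltingsArchTerm_le_fd (V : WeierstrassCurve ℂ) [V.IsElliptic] :
    Real.log (max ‖V.j‖ 1) + V.faltingsArchTerm ≤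
      6 * Real.log (1 + Real.log (max ‖V.j‖ 1)) + Real.log (65536 * π ^ 12) := by
  obtain ⟨τ, hτ, hj, hX⟩ := exists_fd_tau V
  set y : ℝ := τ.im with hy_def
  set e4 : ℝ := ‖E₄ τ‖ with he4
  set d : ℝ := ‖ModularForm.discriminant τ‖ with hd_def
  set Lj : ℝ := Real.log (max ‖V.j‖ 1) with hLj
  have h34 : 3 ≤ 4 * τ.im ^ 2 := ModularGroup.three_le_four_mul_im_sq_of_mem_fd hτ
  have hy86 : (43 / 50 : ℝ) ≤ y := im_ge_of_three_le h34
  have hy : 1 / 2 ≤ y := by linarith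
  have hypos : 0 < y := by linarith
  have hd : 0 < d := norm_pos_iff.mpr (ModularForm.discriminant_ne_zero τ)
  have he4nn : 0 ≤ e4 := norm_nonneg _
  have hmaxpos : 0 < max ‖V.j‖ 1 := lt_max_of_lt_right one_pos
  have hLj0 : 0 ≤ Lj := Real.log_nonneg (le_max_right _ _)
  -- `max(|j|,1)·d = max(d, e4³) ≤ 16`
  have hmaxd : max ‖V.j‖ 1 * d = max d (e4 ^ 3) := by
    rw [hj, max_mul_of_nonneg _ _ hd.le, div_mul_cancel₀ _ hd.ne', one_mul, max_comm]
  have hΦpos : 0 < max d (e4 ^ 3) := lt_max_of_lt_left hd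
  have hdle : d ≤ 4 * Real.exp (-(2 * π * y)) := norm_discriminant_le τ hy
  have hexp : Real.exp (-(2 * π * y)) ≤ 1 / 200 := exp_neg_two_pi_mul_im_le h34
  have he4le : e4 ≤ 5 / 2 := norm_E₄_le_of_three_le τ h34
  have hΦle : max d (e4 ^ 3) ≤ 16 := by
    refine max_le (by linarith) ?_
    calc e4 ^ 3 ≤ (5 / 2 : ℝ) ^ 3 := pow_le_pow_left₀ he4nn he4le 3
      _ ≤ 16 := by norm_num
  have h1 : Real.log (max ‖V.j‖ 1 * d) ≤ Real.log 16 := by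
    rw [hmaxd]; exact Real.log_le_log hΦpos hΦle
  -- `y ≤ 1 + Lj`
  have hyle : y ≤ 1 + Lj := by
    rcases le_or_gt y 1 with h | h
    · linarith
    · have he4ge : 1 / 4 ≤ e4 := one_quarter_le_norm_E₄ τ h.le
      have hjge : Real.exp (2 * π * y) / 256 ≤ ‖V.j‖ := by
        rw [hj]
        have h64 : (1 / 4 : ℝ) ^ 3 ≤ e4 ^ 3 := pow_le_pow_left₀ (by norm_num) he4ge 3
        rw [div_le_div_iff₀ (by norm_num) hd]
        have hprod : Real.exp (2 * π * y) * Real.exp (-(2 * π * y)) = 1 := by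
          rw [← Real.exp_add]; simp
        nlinarith [Real.exp_pos (2 * π * y)]
      have hjle : ‖V.j‖ ≤ max ‖V.j‖ 1 := le_max_left _ _
      have hlog : 2 * π * y - Real.log 256 ≤ Lj := by
        have hpos : 0 < Real.exp (2 * π * y) / 256 := by positivity
        have := Real.log_le_log hpos (hjge.trans hjle)
        rwa [Real.log_div (Real.exp_pos _).ne' (by norm_num), Real.log_exp] at this
      have h256 : Real.log 256 ≤ 6 := by
        rw [show (256 : ℝ) = 2 ^ 8 by norm_num, Real.log_pow]
        have := Real.log_two_lt_d9; norm_num at this ⊢; linarith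
      have hπ : (3 : ℝ) ≤ π := Real.pi_gt_three.le
      nlinarith
  have h2 : Real.log y ≤ Real.log (1 + Lj) := Real.log_le_log hypos hyle
  have hlog : Real.log (4096 * π ^ 12) + Real.log 16 = Real.log (65536 * π ^ 12) := by
    rw [← Real.log_mul (by positivity) (by positivity)]
    congr 1; ring
  rw [hX]
  linarith

/-- `log(65536 π¹²) ≤ 25` (`π ≤ 3.1416`, `e ≥ 2.7182818283`). [folklore] -/
private theorem log_const_le : Real.log (65536 * π ^ 12) ≤ 25 := by
  have hπ4 : π ≤ 3.1416 := Real.pi_lt_d4.le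
  have hπ12 : π ^ 12 ≤ (3.1416 : ℝ) ^ 12 := pow_le_pow_left₀ Real.pi_pos.le hπ4 12
  have he25 : (65536 * (3.1416 : ℝ) ^ 12) ≤ Real.exp 25 := by
    have h2 : (2.7182818283 : ℝ) ≤ Real.exp 1 := Real.exp_one_gt_d9.le
    have : Real.exp 25 = Real.exp 1 ^ 25 := by rw [← Real.exp_nat_mul]; norm_num
    rw [this]
    exact le_trans (by norm_num) (pow_le_pow_left₀ (by norm_num) h2 25)
  refine (Real.log_le_iff_le_exp (by positivity)).2 (le_trans ?_ he25)
  gcongr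

/-- `log(65536 π¹²) = 16 log 2 + 12 log π`. [folklore] -/
private theorem log_const_eq : Real.log (65536 * π ^ 12) = 16 * Real.log 2 + 12 * Real.log π := by
  rw [Real.log_mul (by norm_num) (by positivity), Real.log_pow, show (65536 : ℝ) = 2 ^ 16 by norm_num,
    Real.log_pow]
  push_cast
  ring

/-! ### The stable Faltings height: `h(j) ≤ 12 h_F + 6 log(1 + h(j)) + log(65536 π¹²)` -/

/-- **`h(j_E) ≤ 12 h_F^{st}(E) + 6 log(1 + h(j_E)) + log(65536 π¹²)`** for every elliptic curve over a
number field `K` (`h(j) = [K:ℚ]⁻¹ log H_K(j)` the absolute Weil height; `h_F^{st}` the tree's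
`stableFaltingsHeight`, Faltings' normalisation): the per-embedding bounds
`log_max_j_add_faltingsArchTerm_le_fd`, the closed formula `12 [K:ℚ] h_F = log N𝔇 − Σ_σ archTerm_σ`,
`log N𝔇 ≥ 0`, and Jensen's inequality `Σ_σ log(1 + L_σ) ≤ [K:ℚ] log(1 + [K:ℚ]⁻¹ Σ_σ L_σ)` — the
summation step of Löbrich's proof ("The geometric-arithmetic mean inequality yields …"), verbatim the
argument of the tree's `jHeight_le_stableFaltingsHeight_explicit` with `37 ↦ log(65536 π¹²)`.
[cite: Lobrich2017, §3 Prop. 3.2 (proof, eqs. (3.3)–(3.4))] -/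
theorem jHeight_le_stableFaltingsHeight_fd (K : Type*) [Field K] [NumberField K]
    (W : WeierstrassCurve K) [W.IsElliptic] :
    (Module.finrank ℚ K : ℝ)⁻¹ * logHeight₁ W.j ≤
      12 * W.stableFaltingsHeight + 6 * Real.log (1 + (Module.finrank ℚ K : ℝ)⁻¹ * logHeight₁ W.j)
        + Real.log (65536 * π ^ 12) := by
  set C : ℝ := Real.log (65536 * π ^ 12) with hC_def
  set n : ℝ := (Module.finrank ℚ K : ℝ) with hn_def
  have hnpos : 0 < n := by
    rw [hn_def]
    exact_mod_cast Module.finrank_pos (R := ℚ) (M := K)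
  have hn : n ≠ 0 := hnpos.ne'
  have hcard : ((Finset.univ : Finset (K →+* ℂ)).card : ℝ) = n := by
    rw [Finset.card_univ, NumberField.Embeddings.card K ℂ]
  set Lσ : (K →+* ℂ) → ℝ := fun σ => Real.log (max ‖σ W.j‖ 1) with hLσ
  have hL0 : ∀ σ, 0 ≤ Lσ σ := fun σ => Real.log_nonneg (le_max_right _ _)
  have hD : 0 ≤ Real.log (Ideal.absNorm W.jDenominatorIdeal) := by
    refine Real.log_nonneg ?_
    have h1 : Ideal.absNorm W.jDenominatorIdeal ≠ 0 := by
      rw [Ne, Ideal.absNorm_eq_zero_iff]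
      exact W.jDenominatorIdeal_ne_bot
    exact_mod_cast Nat.one_le_iff_ne_zero.mpr h1
  -- per embedding: `L_σ + archTerm_σ ≤ 6 log(1 + L_σ) + C`
  have hσ : ∀ σ : K →+* ℂ, Lσ σ + (W.map σ).faltingsArchTerm ≤ 6 * Real.log (1 + Lσ σ) + C := by
    intro σ
    haveI : (W.map σ).IsElliptic := by infer_instance
    have h := log_max_j_add_faltingsArchTerm_le_fd (W.map σ)
    rw [WeierstrassCurve.map_j] at h
    exact h
  have hsum : ∑ σ : K →+* ℂ, (Lσ σ + (W.map σ).faltingsArchTerm) ≤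
      6 * ∑ σ : K →+* ℂ, Real.log (1 + Lσ σ) + n * C := by
    calc ∑ σ : K →+* ℂ, (Lσ σ + (W.map σ).faltingsArchTerm)
        ≤ ∑ σ : K →+* ℂ, (6 * Real.log (1 + Lσ σ) + C) := Finset.sum_le_sum fun σ _ => hσ σ
      _ = 6 * ∑ σ : K →+* ℂ, Real.log (1 + Lσ σ) + n * C := by
          rw [Finset.sum_add_distrib, Finset.sum_const, nsmul_eq_mul, hcard, ← Finset.mul_sum]
  rw [Finset.sum_add_distrib] at hsum
  -- Jensen
  have hJ : ∑ σ : K →+* ℂ, n⁻¹ • Real.log (1 + Lσ σ) ≤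
      Real.log (∑ σ : K →+* ℂ, n⁻¹ • (1 + Lσ σ)) :=
    (strictConcaveOn_log_Ioi.concaveOn).le_map_sum (t := Finset.univ)
      (fun σ _ => inv_nonneg.mpr hnpos.le)
      (by rw [Finset.sum_const, nsmul_eq_mul, hcard]; field_simp)
      (fun σ _ => Set.mem_Ioi.mpr (by linarith [hL0 σ]))
  simp only [smul_eq_mul] at hJ
  rw [← Finset.mul_sum, ← Finset.mul_sum, Finset.sum_add_distrib, Finset.sum_const,
    nsmul_eq_mul, hcard, mul_add, mul_one, inv_mul_cancel₀ hn] at hJ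
  have hsumL : n⁻¹ * ∑ σ : K →+* ℂ, Lσ σ ≤ n⁻¹ * logHeight₁ W.j := by
    rw [logHeight₁_j_eq_sum_embeddings]; gcongr; linarith
  have hmono : Real.log (1 + n⁻¹ * ∑ σ : K →+* ℂ, Lσ σ) ≤
      Real.log (1 + n⁻¹ * logHeight₁ W.j) := by
    refine Real.log_le_log ?_ (by linarith)
    have : 0 ≤ n⁻¹ * ∑ σ : K →+* ℂ, Lσ σ :=
      mul_nonneg (inv_nonneg.mpr hnpos.le) (Finset.sum_nonneg fun σ _ => hL0 σ)
    linarith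
  -- `12 n h_F = log N𝔇 − Σ archTerm`
  have hF : 12 * W.stableFaltingsHeight =
      n⁻¹ * (Real.log (Ideal.absNorm W.jDenominatorIdeal) -
        ∑ σ : K →+* ℂ, (W.map σ).faltingsArchTerm) := by
    rw [WeierstrassCurve.stableFaltingsHeight, ← hn_def]
    field_simp
  -- assemble: `h(j) = n⁻¹ log N𝔇 + n⁻¹ Σ L_σ`
  have hh : n⁻¹ * logHeight₁ W.j = n⁻¹ * Real.log (Ideal.absNorm W.jDenominatorIdeal) +
      n⁻¹ * ∑ σ : K →+* ℂ, Lσ σ := by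
    rw [logHeight₁_j_eq_sum_embeddings, mul_add]
  have hmain : n⁻¹ * ∑ σ : K →+* ℂ, Lσ σ + n⁻¹ * ∑ σ : K →+* ℂ, (W.map σ).faltingsArchTerm ≤
      6 * (n⁻¹ * ∑ σ : K →+* ℂ, Real.log (1 + Lσ σ)) + C := by
    have := mul_le_mul_of_nonneg_left hsum (inv_nonneg.mpr hnpos.le)
    rw [mul_add, mul_add, ← mul_assoc n⁻¹ 6, mul_comm n⁻¹ 6, mul_assoc, ← mul_assoc n⁻¹ n,
      inv_mul_cancel₀ hn, one_mul] at this
    exact this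
  have hF' : 12 * W.stableFaltingsHeight = n⁻¹ * Real.log (Ideal.absNorm W.jDenominatorIdeal) -
      n⁻¹ * ∑ σ : K →+* ℂ, (W.map σ).faltingsArchTerm := by rw [hF, mul_sub]
  have ha : 0 ≤ n⁻¹ * Real.log (Ideal.absNorm W.jDenominatorIdeal) :=
    mul_nonneg (inv_nonneg.mpr hnpos.le) hD
  linarith [hmain, hJ, hmono, hh, hF']

/-- **Numerically: `h(j_E) ≤ 12 h_F^{st}(E) + 6 log(1 + h(j_E)) + 25`.** [cite: Lobrich2017, §3 Prop. 3.2] -/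
theorem jHeight_le_stableFaltingsHeight_twentyFive (K : Type*) [Field K] [NumberField K]
    (W : WeierstrassCurve K) [W.IsElliptic] :
    (Module.finrank ℚ K : ℝ)⁻¹ * logHeight₁ W.j ≤
      12 * W.stableFaltingsHeight + 6 * Real.log (1 + (Module.finrank ℚ K : ℝ)⁻¹ * logHeight₁ W.j)
        + 25 := by
  have h := jHeight_le_stableFaltingsHeight_fd K W
  linarith [log_const_le]

/-- **Löbrich 2017, Prop. 3.2 — stable form, together with the lower inequality of Prop. 3.1** (the
shape of [ExpEst] Prop. 1.10): for every elliptic curve `E` over a number field, with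
`h(j_E) = [K:ℚ]⁻¹ log H_K(j_E)` and `h(E) := h_F^{st}(E) + ½ log π` (Deligne's normalisation,
loc. cit. Def. 2.3 / Remark 2.1),
`0 ≤ h(j_E)/12 − h(E) ≤ ½ log(1 + h(j_E)) + 2.071`.
Print: "`h(E/K) > (1/12)h(j_E) − ½ log(1 + h(j_E)) + (1/(12[K:ℚ])) log|N_{K/ℚ}(γ_{E/K})| − 2.071`"
(over a field where `E` is semistable, `γ_{E/K} = 𝓞_K` and `h(E/K)` is the stable height), and
Prop. 3.1 with "one can choose `C₁ = 0.72`" (`≥ 0`); here the lower bound is the tree's explicit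
Silverman constant `9/12 ≥ ½ log π` (`stableFaltingsHeight_le_logHeight₁`) and the upper bound is
`jHeight_le_stableFaltingsHeight_fd` with `(16 log 2 + 6 log π)/12 ≈ 1.50 ≤ 2.071`.
[cite: Lobrich2017, §3 Prop. 3.2 and Prop. 3.1] -/
theorem lobrich2017_prop32_stable (K : Type*) [Field K] [NumberField K]
    (W : WeierstrassCurve K) [W.IsElliptic] :
    0 ≤ (Module.finrank ℚ K : ℝ)⁻¹ * logHeight₁ W.j / 12 -
        (W.stableFaltingsHeight + 1 / 2 * Real.log π) ∧
      (Module.finrank ℚ K : ℝ)⁻¹ * logHeight₁ W.j / 12 -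
          (W.stableFaltingsHeight + 1 / 2 * Real.log π) ≤
        1 / 2 * Real.log (1 + (Module.finrank ℚ K : ℝ)⁻¹ * logHeight₁ W.j) + 2.071 := by
  have hup := jHeight_le_stableFaltingsHeight_fd K W
  have hlow := stableFaltingsHeight_le_logHeight₁ W
  have hl2 : Real.log 2 < 0.6931471808 := Real.log_two_lt_d9
  have hπ : Real.log π ≤ 2 * Real.log 2 := by
    rw [← Real.log_rpow two_pos, show ((2 : ℝ) ^ (2 : ℝ)) = 4 by norm_num]
    exact Real.log_le_log Real.pi_pos Real.pi_lt_four.le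
  have hπ0 : 0 ≤ Real.log π := Real.log_nonneg (by linarith [Real.pi_gt_three])
  rw [log_const_eq] at hup
  constructor
  · nlinarith
  · nlinarith

end FaltingsHeightLobrich

end Literature.NumberTheory.DiophantineGeometry

end
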